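import Literature.NumberTheory.Sieve.SieveFrameworkUpperBound
import Literature.NumberTheory.Sieve.BombieriAsymptoticSieve
import Literature.NumberTheory.LFunctions.MertensTail
import HarnessLib

/-!
# Matomäki–Radziwiłł–Tao 2015, §2: numbers with typical factorization

K. Matomäki, M. Radziwiłł, T. Tao, *An averaged form of Chowla's conjecture*, Algebra & Number
Theory **9** (2015), 2167–2196 (arXiv:1503.05121), §2 "Restricting to numbers with typical
factorization".  Everything in this file is PROVED.

* `Literature.MRT2015.seqP P₁ Q₁`, `Literature.MRT2015.seqQ Q₁` — the sequences `P_j, Q_j` of Definition 2.1: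
  `P_j = exp(j^{4j} (log Q₁)^{j-1} log P₁)`, `Q_j = exp(j^{4j+2} (log Q₁)^j)` for `j > 1`
  (`P_1 = P₁`, `Q_1 = Q₁`; the junk index `j = 0` is sent to `P₁, Q₁` as well);
* `Literature.MRT2015.IsTypical P₁ Q₁ X₀ n` — "`n` has at least one prime factor in `[P_j, Q_j]` for
  each `1 ≤ j ≤ J`", where `J` is the largest index with `Q_J ≤ exp(√(log X₀))`; since `Q_j` is
  increasing this is rendered as "for every `j ≥ 1` with `Q_j ≤ exp(√(log X₀))`";
  `Literature.MRT2015.typicalSet P₁ Q₁ X₀ X = 𝒮_{P₁,Q₁,X₀,X} = {1 ≤ n ≤ X : IsTypical n}` (a `Finset`);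
* `Literature.NumberTheory.LFunctions.MRT2015.log_seqP_div_log_seqQ` — `log P_j / log Q_j = (1/j²) · log P₁ / log Q₁`;
* `Literature.NumberTheory.LFunctions.MRT2015.card_not_hasFactorIn_le` — the upper-bound sieve input: for `2 ≤ P ≤ Q`,
  `#{1 ≤ n ≤ X : n has no prime factor in [P, Q]} ≤ C₀ X log P / log Q + (Q + 1)^{10}`
  (beta-sieve upper bound of the tree, `SieveSequence.sifted_le_of_dvd_primesProdBelow`, for the
  integers sifted by the primes of `[P, Q]`, and Mertens' product bound
  `MertensBound.prod_one_sub_inv_prime_Icc_le`);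
* `Literature.NumberTheory.LFunctions.MRT2015.lemma22` — **Lemma 2.2** PROVED: there are absolute `C, X⁎` such that for
  `X ≥ X⁎`, `10 < P₁ < Q₁ ≤ X`, `√X ≤ X₀ ≤ X`, `Q₁ ≤ exp(√(log X₀))`,
  `#{1 ≤ n ≤ X : n ∉ 𝒮_{P₁,Q₁,X₀,X}} ≤ C (log P₁ / log Q₁) X`.

## References
* [MRT2015] K. Matomäki, M. Radziwiłł, T. Tao, Algebra & Number Theory 9 (2015), 2167–2196,
  Definition 2.1 and Lemma 2.2 (with its proof: fundamental lemma of sieve theory, summed over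
  `j`). [cite: MatomakiRadziwillTao2015, Definition 2.1 and Lemma 2.2]
* J. Friedlander, H. Iwaniec, *Opera de Cribro*, Thm 6.9 (the upper-bound sieve used).

## Design choices
* All of `P₁, Q₁, X₀, X` are real; `n` ranges over `Finset.Icc 1 ⌊X⌋₊`.
* The density statement uses an absolute constant `C` and an absolute threshold `X⁎` ("for every
  large enough `X`"), both existentially quantified outermost.
-/

open Finset Real

noncomputable section

open scoped Classical

namespace Literature.NumberTheory.LFunctions

namespace MRT2015

/-! ### Definition 2.1: the sequences `P_j`, `Q_j` -/

/-- `P_j` of [MRT2015, Def. 2.1]: `P_1 = P₁` and `P_j = exp(j^{4j} (log Q₁)^{j-1} log P₁)` for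
`j > 1` (the value at the junk index `j = 0` is `P₁`).
[cite: MatomakiRadziwillTao2015, Definition 2.1] -/
def seqP (P₁ Q₁ : ℝ) (j : ℕ) : ℝ :=
  if j ≤ 1 then P₁ else Real.exp ((j : ℝ) ^ (4 * j) * Real.log Q₁ ^ (j - 1) * Real.log P₁)

/-- `Q_j` of [MRT2015, Def. 2.1]: `Q_1 = Q₁` and `Q_j = exp(j^{4j+2} (log Q₁)^j)` for `j > 1`
(junk value `Q₁` at `j = 0`). [cite: MatomakiRadziwillTao2015, Definition 2.1] -/
def seqQ (Q₁ : ℝ) (j : ℕ) : ℝ :=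
  if j ≤ 1 then Q₁ else Real.exp ((j : ℝ) ^ (4 * j + 2) * Real.log Q₁ ^ j)

variable {P₁ Q₁ X₀ X : ℝ}

/-- `P_1 = P₁` (definition). [cite: MatomakiRadziwillTao2015, Definition 2.1] -/
theorem seqP_one : seqP P₁ Q₁ 1 = P₁ := by simp [seqP]

/-- `Q_1 = Q₁` (definition). [cite: MatomakiRadziwillTao2015, Definition 2.1] -/
theorem seqQ_one : seqQ Q₁ 1 = Q₁ := by simp [seqQ]

/-- `P_j = exp(j^{4j} (log Q₁)^{j-1} log P₁)` for `j ≥ 2` (definition). [cite: MatomakiRadziwillTao2015, Definition 2.1] -/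
theorem seqP_of_two_le {j : ℕ} (hj : 2 ≤ j) :
    seqP P₁ Q₁ j = Real.exp ((j : ℝ) ^ (4 * j) * Real.log Q₁ ^ (j - 1) * Real.log P₁) := by
  simp [seqP, show ¬ j ≤ 1 by omega]

/-- `Q_j = exp(j^{4j+2} (log Q₁)^j)` for `j ≥ 2` (definition). [cite: MatomakiRadziwillTao2015, Definition 2.1] -/
theorem seqQ_of_two_le {j : ℕ} (hj : 2 ≤ j) :
    seqQ Q₁ j = Real.exp ((j : ℝ) ^ (4 * j + 2) * Real.log Q₁ ^ j) := by
  simp [seqQ, show ¬ j ≤ 1 by omega]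

/-- `log P_j = j^{4j} (log Q₁)^{j-1} log P₁` for `j ≥ 2`. [cite: MatomakiRadziwillTao2015, Definition 2.1] -/
theorem log_seqP_of_two_le {j : ℕ} (hj : 2 ≤ j) :
    Real.log (seqP P₁ Q₁ j) = (j : ℝ) ^ (4 * j) * Real.log Q₁ ^ (j - 1) * Real.log P₁ := by
  rw [seqP_of_two_le hj, Real.log_exp]

/-- `log Q_j = j^{4j+2} (log Q₁)^j` for `j ≥ 2`. [cite: MatomakiRadziwillTao2015, Definition 2.1] -/
theorem log_seqQ_of_two_le {j : ℕ} (hj : 2 ≤ j) :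
    Real.log (seqQ Q₁ j) = (j : ℝ) ^ (4 * j + 2) * Real.log Q₁ ^ j := by
  rw [seqQ_of_two_le hj, Real.log_exp]

/-- `log P_j / log Q_j = log P₁ / (j² log Q₁)` for every `j ≥ 1` (for `j ≥ 2` this needs
`log Q₁ ≠ 0`). [cite: MatomakiRadziwillTao2015, proof of Lemma 2.2] -/
theorem log_seqP_div_log_seqQ {j : ℕ} (hj : 1 ≤ j) (hQ : Real.log Q₁ ≠ 0) :
    Real.log (seqP P₁ Q₁ j) / Real.log (seqQ Q₁ j) =
      Real.log P₁ / Real.log Q₁ / (j : ℝ) ^ 2 := by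
  rcases Nat.lt_or_ge j 2 with h | h
  · obtain rfl : j = 1 := by omega
    simp [seqP_one, seqQ_one]
  · rw [log_seqP_of_two_le h, log_seqQ_of_two_le h]
    have hj0 : (j : ℝ) ≠ 0 := by exact_mod_cast (show j ≠ 0 by omega)
    have e1 : (j : ℝ) ^ (4 * j + 2) = (j : ℝ) ^ (4 * j) * (j : ℝ) ^ 2 := by rw [pow_add]
    have e2 : Real.log Q₁ ^ j = Real.log Q₁ ^ (j - 1) * Real.log Q₁ := by
      rw [← pow_succ, Nat.sub_add_cancel hj]
    rw [e1, e2]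
    field_simp

/-- `P_j ≥ P₁` as soon as `P₁ > 1` and `log Q₁ ≥ 1`. [cite: MatomakiRadziwillTao2015, Definition 2.1] -/
theorem le_seqP {j : ℕ} (hP : 1 < P₁) (hQ : 1 ≤ Real.log Q₁) : P₁ ≤ seqP P₁ Q₁ j := by
  rcases Nat.lt_or_ge j 2 with h | h
  · simp [seqP, show j ≤ 1 by omega]
  · rw [seqP_of_two_le h]
    have hlogP : 0 < Real.log P₁ := Real.log_pos hP
    calc P₁ = Real.exp (Real.log P₁) := (Real.exp_log (by linarith)).symm
      _ ≤ _ := by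
        refine Real.exp_le_exp.mpr ?_
        have h1 : (1 : ℝ) ≤ (j : ℝ) ^ (4 * j) * Real.log Q₁ ^ (j - 1) := by
          have hj1 : (1 : ℝ) ≤ j := by exact_mod_cast (show 1 ≤ j by omega)
          exact one_le_mul_of_one_le_of_one_le (one_le_pow₀ hj1) (one_le_pow₀ hQ)
        nlinarith

/-- `log Q_j ≥ j` for `j ≥ 1` when `log Q₁ ≥ 1`. [cite: MatomakiRadziwillTao2015, Definition 2.1] -/
theorem le_log_seqQ {j : ℕ} (hj : 1 ≤ j) (hQ : 1 ≤ Real.log Q₁) :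
    (j : ℝ) ≤ Real.log (seqQ Q₁ j) := by
  rcases Nat.lt_or_ge j 2 with h | h
  · obtain rfl : j = 1 := by omega
    simpa [seqQ_one] using hQ
  · rw [log_seqQ_of_two_le h]
    have hj1 : (1 : ℝ) ≤ j := by exact_mod_cast (show 1 ≤ j by omega)
    calc (j : ℝ) = (j : ℝ) ^ 1 * 1 := by ring
      _ ≤ (j : ℝ) ^ (4 * j + 2) * Real.log Q₁ ^ j :=
        mul_le_mul (pow_le_pow_right₀ hj1 (by omega)) (one_le_pow₀ hQ) zero_le_one
          (pow_nonneg (by linarith) _)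

/-! ### Definition 2.1: the set `𝒮_{P₁,Q₁,X₀,X}` -/

/-- `n` has a prime factor in the real interval `[P, Q]`. [cite: MatomakiRadziwillTao2015, Definition 2.1] -/
def HasFactorIn (n : ℕ) (P Q : ℝ) : Prop :=
  ∃ p : ℕ, p.Prime ∧ p ∣ n ∧ P ≤ p ∧ (p : ℝ) ≤ Q

/-- **Typical factorization** [MRT2015, Def. 2.1]: `n` has at least one prime factor in
`[P_j, Q_j]` for every `1 ≤ j ≤ J`, `J` the largest index with `Q_J ≤ exp(√(log X₀))`; as the
`Q_j` increase, "`j ≤ J`" is rendered as "`Q_j ≤ exp(√(log X₀))`".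
[cite: MatomakiRadziwillTao2015, Definition 2.1] -/
def IsTypical (P₁ Q₁ X₀ : ℝ) (n : ℕ) : Prop :=
  ∀ j : ℕ, 1 ≤ j → seqQ Q₁ j ≤ Real.exp (Real.sqrt (Real.log X₀)) →
    HasFactorIn n (seqP P₁ Q₁ j) (seqQ Q₁ j)

/-- The set `𝒮_{P₁,Q₁,X₀,X}` of [MRT2015, Def. 2.1]: all `1 ≤ n ≤ X` with typical factorization.
[cite: MatomakiRadziwillTao2015, Definition 2.1] -/
def typicalSet (P₁ Q₁ X₀ X : ℝ) : Finset ℕ :=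
  (Icc 1 ⌊X⌋₊).filter fun n => IsTypical P₁ Q₁ X₀ n

/-- Membership in `𝒮_{P₁,Q₁,X₀,X}` (unfolding). [cite: MatomakiRadziwillTao2015, Definition 2.1] -/
theorem mem_typicalSet {n : ℕ} :
    n ∈ typicalSet P₁ Q₁ X₀ X ↔ (1 ≤ n ∧ n ≤ ⌊X⌋₊) ∧ IsTypical P₁ Q₁ X₀ n := by
  simp [typicalSet]

/-- Elements of `𝒮` are `≥ 1`. [cite: MatomakiRadziwillTao2015, Definition 2.1] -/
theorem one_le_of_mem_typicalSet {n : ℕ} (h : n ∈ typicalSet P₁ Q₁ X₀ X) : 1 ≤ n :=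
  (mem_typicalSet.mp h).1.1

/-- Elements of `𝒮_{P₁,Q₁,X₀,X}` are `≤ X`. [cite: MatomakiRadziwillTao2015, Definition 2.1] -/
theorem le_of_mem_typicalSet {n : ℕ} (h : n ∈ typicalSet P₁ Q₁ X₀ X) : (n : ℝ) ≤ X := by
  have h1 := (mem_typicalSet.mp h).1
  rcases lt_or_ge X 0 with hX | hX
  · exact absurd (Nat.floor_of_nonpos hX.le ▸ h1.2) (by omega)
  · exact (Nat.cast_le.mpr h1.2).trans (Nat.floor_le hX)

/-- Every element of `𝒮` has a prime factor in `[P₁, Q₁]` provided `Q₁ ≤ exp(√(log X₀))`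
(the case `j = 1`). [cite: MatomakiRadziwillTao2015, Definition 2.1] -/
theorem hasFactorIn_of_mem_typicalSet {n : ℕ} (h : n ∈ typicalSet P₁ Q₁ X₀ X)
    (hQ : Q₁ ≤ Real.exp (Real.sqrt (Real.log X₀))) : HasFactorIn n P₁ Q₁ := by
  have := (mem_typicalSet.mp h).2 1 le_rfl (by simpa [seqQ_one] using hQ)
  simpa [seqP_one, seqQ_one] using this

/-- `Q_j > 0` when `Q₁ > 0`. [cite: MatomakiRadziwillTao2015, Definition 2.1] -/
theorem seqQ_pos (hQ : 0 < Q₁) (j : ℕ) : 0 < seqQ Q₁ j := by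
  rcases Nat.lt_or_ge j 2 with h | h
  · simpa [seqQ, show j ≤ 1 by omega] using hQ
  · rw [seqQ_of_two_le h]; exact Real.exp_pos _

/-- `P_j > 0` when `P₁ > 0`. [cite: MatomakiRadziwillTao2015, Definition 2.1] -/
theorem seqP_pos (hP : 0 < P₁) (j : ℕ) : 0 < seqP P₁ Q₁ j := by
  rcases Nat.lt_or_ge j 2 with h | h
  · simpa [seqP, show j ≤ 1 by omega] using hP
  · rw [seqP_of_two_le h]; exact Real.exp_pos _

/-- Indices beyond `√(log X₀)` never occur in the definition of `𝒮` when `log Q₁ ≥ 1`: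
if `j ≥ 1` and `Q_j ≤ exp(√(log X₀))` then `j ≤ √(log X₀)`. [cite: MatomakiRadziwillTao2015, Definition 2.1] -/
theorem index_le_sqrt_log {j : ℕ} (hj : 1 ≤ j) (hQ0 : 0 < Q₁) (hQ : 1 ≤ Real.log Q₁)
    (h : seqQ Q₁ j ≤ Real.exp (Real.sqrt (Real.log X₀))) :
    (j : ℝ) ≤ Real.sqrt (Real.log X₀) := by
  have h1 := le_log_seqQ (Q₁ := Q₁) hj hQ
  have h2 := Real.log_le_log (seqQ_pos hQ0 j) h
  rw [Real.log_exp] at h2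
  exact h1.trans h2


/-- `P_j ≤ Q_j` for `j ≥ 1` when `0 < log P₁ ≤ log Q₁`. [cite: MatomakiRadziwillTao2015, Definition 2.1] -/
theorem seqP_le_seqQ {j : ℕ} (hj : 1 ≤ j) (hP : 0 ≤ Real.log P₁) (hPQ : Real.log P₁ ≤ Real.log Q₁)
    (hPQ' : P₁ ≤ Q₁) : seqP P₁ Q₁ j ≤ seqQ Q₁ j := by
  rcases Nat.lt_or_ge j 2 with h | h
  · obtain rfl : j = 1 := by omega
    simpa [seqP_one, seqQ_one] using hPQ'
  · rw [seqP_of_two_le h, seqQ_of_two_le h]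
    refine Real.exp_le_exp.mpr ?_
    have hj1 : (1 : ℝ) ≤ j := by exact_mod_cast (show 1 ≤ j by omega)
    have hQ0 : 0 ≤ Real.log Q₁ := hP.trans hPQ
    have e1 : (j : ℝ) ^ (4 * j + 2) * Real.log Q₁ ^ j =
        (j : ℝ) ^ (4 * j) * Real.log Q₁ ^ (j - 1) * ((j : ℝ) ^ 2 * Real.log Q₁) := by
      rw [pow_add, show Real.log Q₁ ^ j = Real.log Q₁ ^ (j - 1) * Real.log Q₁ by
        rw [← pow_succ, Nat.sub_add_cancel (by omega : 1 ≤ j)]]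
      ring
    rw [e1]
    refine mul_le_mul_of_nonneg_left ?_ (by positivity)
    calc Real.log P₁ ≤ Real.log Q₁ := hPQ
      _ = 1 * Real.log Q₁ := (one_mul _).symm
      _ ≤ (j : ℝ) ^ 2 * Real.log Q₁ := mul_le_mul_of_nonneg_right (one_le_pow₀ hj1) hQ0

/-! ### Scaling by a number with small prime factors -/

/-- If all prime factors of `d ≥ 1` are `< P`, then `d m` has a prime factor in `[P, Q]` iff `m`
does. [cite: MatomakiRadziwillTao2015, §2 (proof of Theorem 2.3: `1_𝒮(dm) = 1_{𝒮_{…,X/d}}(m)`)] -/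
theorem hasFactorIn_mul_iff {d m : ℕ} {P Q : ℝ}
    (hsmall : ∀ p : ℕ, p.Prime → p ∣ d → (p : ℝ) < P) :
    HasFactorIn (d * m) P Q ↔ HasFactorIn m P Q := by
  constructor
  · rintro ⟨p, hp, hpdm, hP, hQ⟩
    refine ⟨p, hp, ?_, hP, hQ⟩
    rcases (Nat.Prime.dvd_mul hp).mp hpdm with h | h
    · exact absurd hP (not_le.mpr (hsmall p hp h))
    · exact h
  · rintro ⟨p, hp, hpm, hP, hQ⟩
    exact ⟨p, hp, Dvd.dvd.mul_left hpm d, hP, hQ⟩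

/-- If all prime factors of `d ≥ 1` are `< P₁ ≤ P_j` (the latter holds when `P₁ > 1`,
`log Q₁ ≥ 1`), then `d m` has typical factorization iff `m` does.
[cite: MatomakiRadziwillTao2015, §2 (proof of Theorem 2.3)] -/
theorem isTypical_mul_iff {d m : ℕ} (hP : 1 < P₁) (hQ : 1 ≤ Real.log Q₁)
    (hsmall : ∀ p : ℕ, p.Prime → p ∣ d → (p : ℝ) < P₁) :
    IsTypical P₁ Q₁ X₀ (d * m) ↔ IsTypical P₁ Q₁ X₀ m := by
  have key : ∀ j, HasFactorIn (d * m) (seqP P₁ Q₁ j) (seqQ Q₁ j) ↔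
      HasFactorIn m (seqP P₁ Q₁ j) (seqQ Q₁ j) := fun j =>
    hasFactorIn_mul_iff fun p hp hpd => (hsmall p hp hpd).trans_le (le_seqP hP hQ)
  simp only [IsTypical, key]

/-- **Scaling the set `𝒮`.** If all prime factors of `d ≥ 1` are `< P₁` (`P₁ > 1`,
`log Q₁ ≥ 1`, `X ≥ 0`), then `d m ∈ 𝒮_{P₁,Q₁,X₀,X} ↔ m ∈ 𝒮_{P₁,Q₁,X₀,X/d}`.
[cite: MatomakiRadziwillTao2015, §2 (proof of Theorem 2.3) and §4] -/
theorem mul_mem_typicalSet_iff {d m : ℕ} (hd : 0 < d) (hP : 1 < P₁) (hQ : 1 ≤ Real.log Q₁)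
    (hsmall : ∀ p : ℕ, p.Prime → p ∣ d → (p : ℝ) < P₁) :
    d * m ∈ typicalSet P₁ Q₁ X₀ X ↔ m ∈ typicalSet P₁ Q₁ X₀ (X / d) := by
  rw [mem_typicalSet, mem_typicalSet, isTypical_mul_iff hP hQ hsmall,
    Nat.floor_div_natCast, Nat.le_div_iff_mul_le hd, mul_comm m d]
  have e : 1 ≤ d * m ↔ 1 ≤ m := by
    rw [Nat.one_le_iff_ne_zero, Nat.one_le_iff_ne_zero, Ne, Nat.mul_eq_zero]
    omega
  rw [e]

/-! ### The upper-bound sieve input -/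

/-- The primes of the real interval `[P, Q]`, as a finset of naturals. [folklore] -/
def primesIcc (P Q : ℝ) : Finset ℕ := (Icc ⌈P⌉₊ ⌊Q⌋₊).filter Nat.Prime

/-- Membership in `primesIcc P Q`: `p` prime with `P ≤ p ≤ Q` (`Q ≥ 0`). [folklore] -/
theorem mem_primesIcc {P Q : ℝ} (hQ : 0 ≤ Q) {p : ℕ} :
    p ∈ primesIcc P Q ↔ p.Prime ∧ P ≤ p ∧ (p : ℝ) ≤ Q := by
  simp only [primesIcc, Finset.mem_filter, Finset.mem_Icc, Nat.ceil_le, Nat.le_floor_iff hQ]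
  tauto

/-- **Upper-bound sieve for an interval of primes.**  There is an absolute `C₀` such that for all
real `2 ≤ P ≤ Q` and `X ≥ 0`,
`#{1 ≤ n ≤ X : n has no prime factor in [P, Q]} ≤ C₀ X log P / log Q + (Q + 1)^{10}`:
the beta-sieve upper bound (`SieveSequence.sifted_le_of_dvd_primesProdBelow`, dimension `1`,
level `D = (Q+1)^{10}`) for the integers sifted by the primes of `[P, Q]`, whose main term
`X ∏_{P ≤ p ≤ Q} (1 - 1/p)` is `≤ e^{6/log P} X log P / log Q` by Mertens
(`MertensBound.prod_one_sub_inv_prime_Icc_le`), and whose remainders are bounded by `1` each.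
This is the "fundamental lemma" input of the proof of [MRT2015, Lemma 2.2].
[cite: MatomakiRadziwillTao2015, proof of Lemma 2.2] -/
theorem card_not_hasFactorIn_le :
    ∃ C₀ : ℝ, 0 < C₀ ∧ ∀ P Q X : ℝ, 2 ≤ P → P ≤ Q → 0 ≤ X →
      (#((Icc 1 ⌊X⌋₊).filter fun n => ¬ HasFactorIn n P Q) : ℝ) ≤
        C₀ * X * (Real.log P / Real.log Q) + (Q + 1) ^ (10 : ℕ) := by
  classical
  obtain ⟨K, hK⟩ := Sieve.hasSieveDimension_reciprocalDensity_one_holds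
  have hK1 : 1 ≤ K := hK.one_le
  refine ⟨(1 + 2 * K ^ (10 : ℕ)) * Real.exp (6 / Real.log 2), by positivity, ?_⟩
  intro P Q X hP hPQ hX
  have hQ : 2 ≤ Q := hP.trans hPQ
  have hP0 : (0 : ℝ) ≤ P := by linarith
  have hQ0 : (0 : ℝ) ≤ Q := by linarith
  set T := primesIcc P Q with hT
  have hTp : ∀ p ∈ T, p.Prime := fun p hp => ((mem_primesIcc hQ0).mp hp).1
  set Pr : ℕ := ∏ p ∈ T, p with hPr
  have hPr0 : Pr ≠ 0 := Finset.prod_ne_zero_iff.mpr fun p hp => (hTp p hp).ne_zero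
  -- the sifting set divides `P(z)` for `z = Q + 1`
  have hdvd : Pr ∣ Sieve.primesProdBelow (Q + 1) := by
    refine Finset.prod_dvd_prod_of_subset _ _ _ fun p hp => ?_
    have hp' := (mem_primesIcc hQ0).mp hp
    refine Nat.mem_primesBelow.mpr ⟨?_, hp'.1⟩
    refine (Nat.lt_ceil).mpr ?_
    linarith [hp'.2.2]
  have hdim : Sieve.HasSieveDimension Sieve.SieveSequence.integers.density 1 K := by
    rw [Sieve.SieveSequence.integers_density]; exact hK
  have hz : (2 : ℝ) ≤ Q + 1 := by linarith
  have hD1 : (1 : ℝ) < (Q + 1) ^ (10 : ℕ) := one_lt_pow₀ (by linarith) (by norm_num)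
  have hlogz : 0 < Real.log (Q + 1) := Real.log_pos (by linarith)
  have hzD : (9 * (1 : ℝ) + 1) * Real.log (Q + 1) ≤ Real.log ((Q + 1) ^ (10 : ℕ)) := by
    rw [Real.log_pow]; norm_num
  have hsize : 0 ≤ Sieve.SieveSequence.integers.size X := by simp
  have hmain := Sieve.SieveSequence.sifted_le_of_dvd_primesProdBelow (A := Sieve.SieveSequence.integers)
    hdim one_pos hz hD1 hzD hsize hdvd
  -- simplify the factor `exp (10 - log D / log z) = 1`
  have hexp : Real.exp ((9 * (1 : ℝ) + 1) - Real.log ((Q + 1) ^ (10 : ℕ)) / Real.log (Q + 1)) = 1 := by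
    rw [Real.log_pow]
    have : (9 * (1 : ℝ) + 1) - (10 : ℕ) * Real.log (Q + 1) / Real.log (Q + 1) = 0 := by
      field_simp; ring
    rw [this, Real.exp_zero]
  rw [hexp, mul_one] at hmain
  -- the sifted quantity dominates our count
  have hcount : (#((Icc 1 ⌊X⌋₊).filter fun n => ¬ HasFactorIn n P Q) : ℝ) ≤
      Sieve.SieveSequence.integers.sifted X Pr := by
    rw [Sieve.SieveSequence.sifted]
    simp only [Sieve.SieveSequence.integers_a, Finset.sum_const, nsmul_eq_mul, mul_one]
    have hsub : ((Icc 1 ⌊X⌋₊).filter fun n => ¬ HasFactorIn n P Q) ⊆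
        (Ioc 0 ⌊X⌋₊).filter fun n : ℕ => n.Coprime Pr := by
      intro n hn
      rw [Finset.mem_filter] at hn ⊢
      refine ⟨Finset.mem_Ioc.mpr (Finset.mem_Icc.mp hn.1), ?_⟩
      rw [hPr]
      refine Nat.Coprime.prod_right fun p hp => ?_
      have hp' := (mem_primesIcc hQ0).mp hp
      rw [Nat.coprime_comm, Nat.Prime.coprime_iff_not_dvd hp'.1]
      intro hpn
      exact hn.2 ⟨p, hp'.1, hpn, hp'.2.1, hp'.2.2⟩
    exact_mod_cast Finset.card_le_card hsub
  -- the main term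
  have hdens : Sieve.SieveSequence.integers.densityProduct Pr ≤
      Real.exp (6 / Real.log 2) * (Real.log P / Real.log Q) := by
    rw [Sieve.SieveSequence.densityProduct, hPr, Nat.primeFactors_prod hTp]
    simp only [Sieve.SieveSequence.integers_density, Sieve.reciprocalDensity_apply]
    calc ∏ p ∈ T, (1 - (p : ℝ)⁻¹) ≤ Real.exp (6 / Real.log P) * (Real.log P / Real.log Q) :=
          MertensBound.prod_one_sub_inv_prime_Icc_le hP hPQ
      _ ≤ Real.exp (6 / Real.log 2) * (Real.log P / Real.log Q) := by
          have hlP : 0 < Real.log P := Real.log_pos (by linarith)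
          have hlQ : 0 < Real.log Q := Real.log_pos (by linarith)
          refine mul_le_mul_of_nonneg_right (Real.exp_le_exp.mpr ?_) (by positivity)
          exact div_le_div_of_nonneg_left (by norm_num) (Real.log_pos (by norm_num))
            (Real.log_le_log (by norm_num) hP)
  have hdens0 : 0 ≤ Sieve.SieveSequence.integers.densityProduct Pr := by
    rw [Sieve.SieveSequence.densityProduct]
    refine Finset.prod_nonneg fun p hp => ?_
    simp only [Sieve.SieveSequence.integers_density, Sieve.reciprocalDensity_apply, sub_nonneg]
    exact inv_le_one_of_one_le₀ (by exact_mod_cast (Nat.prime_of_mem_primeFactors hp).one_lt.le)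
  -- the remainder term
  have hrem : ∑ d ∈ Pr.divisors.filter (fun d : ℕ => (d : ℝ) ≤ (Q + 1) ^ (10 : ℕ)),
      |Sieve.SieveSequence.integers.remainder d X| ≤ (Q + 1) ^ (10 : ℕ) := by
    calc ∑ d ∈ Pr.divisors.filter (fun d : ℕ => (d : ℝ) ≤ (Q + 1) ^ (10 : ℕ)),
          |Sieve.SieveSequence.integers.remainder d X|
        ≤ ∑ d ∈ Pr.divisors.filter (fun d : ℕ => (d : ℝ) ≤ (Q + 1) ^ (10 : ℕ)), (1 : ℝ) :=
          Finset.sum_le_sum fun d _ => Sieve.SieveSequence.abs_integers_remainder_le d X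
      _ = #(Pr.divisors.filter (fun d : ℕ => (d : ℝ) ≤ (Q + 1) ^ (10 : ℕ))) := by simp
      _ ≤ #(Icc 1 ⌊(Q + 1) ^ (10 : ℕ)⌋₊) := by
          refine Nat.cast_le.mpr (Finset.card_le_card fun d hd => ?_)
          rw [Finset.mem_filter, Nat.mem_divisors] at hd
          rw [Finset.mem_Icc]
          exact ⟨Nat.pos_of_dvd_of_pos hd.1.1 (Nat.pos_of_ne_zero hPr0),
            Nat.le_floor hd.2⟩
      _ = (⌊(Q + 1) ^ (10 : ℕ)⌋₊ : ℝ) := by simp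
      _ ≤ (Q + 1) ^ (10 : ℕ) := Nat.floor_le (by positivity)
  have hXfloor : (⌊X⌋₊ : ℝ) ≤ X := Nat.floor_le hX
  have hsizeX : Sieve.SieveSequence.integers.size X = (⌊X⌋₊ : ℝ) := by simp
  rw [hsizeX] at hmain
  have hK10 : 0 ≤ 1 + 2 * K ^ (10 : ℕ) := by positivity
  calc (#((Icc 1 ⌊X⌋₊).filter fun n => ¬ HasFactorIn n P Q) : ℝ)
      ≤ Sieve.SieveSequence.integers.sifted X Pr := hcount
    _ ≤ (1 + 2 * K ^ (10 : ℕ)) * ((⌊X⌋₊ : ℝ) * Sieve.SieveSequence.integers.densityProduct Pr) +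
          ∑ d ∈ Pr.divisors.filter (fun d : ℕ => (d : ℝ) ≤ (Q + 1) ^ (10 : ℕ)),
            |Sieve.SieveSequence.integers.remainder d X| := hmain
    _ ≤ (1 + 2 * K ^ (10 : ℕ)) * (X * (Real.exp (6 / Real.log 2) * (Real.log P / Real.log Q))) +
          (Q + 1) ^ (10 : ℕ) := by
        gcongr
    _ = (1 + 2 * K ^ (10 : ℕ)) * Real.exp (6 / Real.log 2) * X * (Real.log P / Real.log Q) +
          (Q + 1) ^ (10 : ℕ) := by ring

/-! ### Lemma 2.2 -/

/-- An explicit growth inequality: for `u ≥ 40`, `2 ^ 10 · u³ · e^{10u} ≤ e^{u²}`. [folklore] -/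
theorem growth_aux {u : ℝ} (hu : 40 ≤ u) :
    (2 : ℝ) ^ (10 : ℕ) * u ^ 3 * Real.exp (10 * u) ≤ Real.exp (u ^ 2) := by
  have h1 : u ^ 2 = (u ^ 2 - 10 * u) + 10 * u := by ring
  rw [h1, Real.exp_add]
  refine mul_le_mul_of_nonneg_right ?_ (Real.exp_pos _).le
  have ht : u ^ 2 / 2 ≤ u ^ 2 - 10 * u := by nlinarith
  have ht0 : 0 ≤ u ^ 2 / 2 := by positivity
  have h2 := Real.pow_div_factorial_le_exp (u ^ 2 / 2) ht0 3
  have h3 : Real.exp (u ^ 2 / 2) ≤ Real.exp (u ^ 2 - 10 * u) := Real.exp_le_exp.mpr ht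
  have h4 : (Nat.factorial 3 : ℝ) = 6 := by norm_num [Nat.factorial]
  rw [h4] at h2
  have h5 : (2 : ℝ) ^ (10 : ℕ) * u ^ 3 ≤ (u ^ 2 / 2) ^ 3 / 6 := by
    rw [div_pow]
    have : (2 : ℝ) ^ (10 : ℕ) * u ^ 3 * 48 ≤ u ^ 6 := by
      have hu3 : (49152 : ℝ) ≤ u ^ 3 := by nlinarith
      nlinarith
    nlinarith
  linarith

/-- **[MRT2015, Lemma 2.2]** (density of `𝒮`): there are absolute constants `C, X⁎` such that
for `X ≥ X⁎`, `10 < P₁ < Q₁ ≤ X` and `√X ≤ X₀ ≤ X` with `Q₁ ≤ exp(√(log X₀))`,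
`#{1 ≤ n ≤ X : n ∉ 𝒮_{P₁,Q₁,X₀,X}} ≤ C · (log P₁ / log Q₁) · X`.
Proof as printed: for each `j ≤ J` the integers without prime factor in `[P_j, Q_j]` are
`≪ X log P_j / log Q_j = X (log P₁ / log Q₁) / j²` by the fundamental lemma (here the
beta-sieve upper bound, `card_not_hasFactorIn_le`), and one sums over `j`; the sieve remainders
`(Q_j + 1)^{10} ≤ (2 e^{√(log X)})^{10}`, `J ≤ √(log X)` of them, are `≤ X / log X` for
`log X ≥ 1600`. [cite: MatomakiRadziwillTao2015, Lemma 2.2] -/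
theorem lemma22 :
    ∃ C Xs : ℝ, 0 < C ∧ ∀ X P₁ Q₁ X₀ : ℝ, Xs ≤ X → 10 < P₁ → P₁ < Q₁ → Q₁ ≤ X →
      Real.sqrt X ≤ X₀ → X₀ ≤ X → Q₁ ≤ Real.exp (Real.sqrt (Real.log X₀)) →
        (#((Icc 1 ⌊X⌋₊).filter fun n => ¬ IsTypical P₁ Q₁ X₀ n) : ℝ) ≤
          C * (Real.log P₁ / Real.log Q₁) * X := by
  classical
  obtain ⟨C₀, hC₀, hsieve⟩ := card_not_hasFactorIn_le
  refine ⟨2 * C₀ + 1, Real.exp 1600, by positivity, ?_⟩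
  intro X P₁ Q₁ X₀ hX hP₁ hPQ hQX hX₀ hX₀X hQE
  -- basic sizes
  have hX1 : Real.exp 1600 ≤ X := hX
  have hX0 : 0 < X := (Real.exp_pos _).trans_le hX1
  have hlogX : 1600 ≤ Real.log X := by
    have := Real.log_le_log (Real.exp_pos _) hX1
    rwa [Real.log_exp] at this
  have hP2 : (2 : ℝ) ≤ P₁ := by linarith
  have hlogP : 0 < Real.log P₁ := Real.log_pos (by linarith)
  have hlog10 : (2 : ℝ) ≤ Real.log 10 := by
    have h := Real.add_one_le_exp (2 : ℝ)
    have h9 : Real.exp 2 ≤ 10 := by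
      have := Real.exp_one_lt_d9
      have h' : Real.exp 2 = Real.exp 1 * Real.exp 1 := by rw [← Real.exp_add]; norm_num
      nlinarith [Real.exp_pos 1]
    calc (2 : ℝ) = Real.log (Real.exp 2) := (Real.log_exp 2).symm
      _ ≤ Real.log 10 := Real.log_le_log (Real.exp_pos _) h9
  have hlogP2 : 2 ≤ Real.log P₁ :=
    hlog10.trans (Real.log_le_log (by norm_num) hP₁.le)
  have hlogQ1 : 1 ≤ Real.log Q₁ := by linarith [Real.log_le_log (by linarith) hPQ.le]
  have hlogPQ : Real.log P₁ ≤ Real.log Q₁ := Real.log_le_log (by linarith) hPQ.le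
  have hlogQX : Real.log Q₁ ≤ Real.log X := Real.log_le_log (by linarith) hQX
  have hlogQ0 : 0 < Real.log Q₁ := by linarith
  have hQ0 : 0 < Q₁ := by linarith
  have hratio : 2 / Real.log X ≤ Real.log P₁ / Real.log Q₁ := by
    rw [div_le_div_iff₀ (by linarith) hlogQ0]
    nlinarith
  -- the exponential bound `E = exp √(log X₀) ≤ exp √(log X)`
  set E := Real.exp (Real.sqrt (Real.log X₀)) with hE
  have hX₀pos : 0 < X₀ := lt_of_lt_of_le (Real.sqrt_pos.mpr hX0) hX₀
  have hlogX₀ : Real.log X₀ ≤ Real.log X := Real.log_le_log hX₀pos hX₀X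
  set u := Real.sqrt (Real.log X) with hu
  have hu40 : 40 ≤ u := by
    rw [hu, show (40 : ℝ) = Real.sqrt (40 ^ 2) by rw [Real.sqrt_sq (by norm_num)]]
    exact Real.sqrt_le_sqrt (by linarith)
  have hu2 : u ^ 2 = Real.log X := Real.sq_sqrt (by linarith)
  have hsqrt_le : Real.sqrt (Real.log X₀) ≤ u := Real.sqrt_le_sqrt hlogX₀
  have hEu : E ≤ Real.exp u := Real.exp_le_exp.mpr hsqrt_le
  have hE1 : 1 ≤ E := by rw [hE]; exact Real.one_le_exp (Real.sqrt_nonneg _)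
  -- index set
  set Jm := ⌊Real.sqrt (Real.log X₀)⌋₊ with hJm
  set Js := (Icc 1 Jm).filter fun j => seqQ Q₁ j ≤ E with hJs
  set bad : ℕ → Finset ℕ := fun j =>
    (Icc 1 ⌊X⌋₊).filter fun n => ¬ HasFactorIn n (seqP P₁ Q₁ j) (seqQ Q₁ j) with hbad
  have hcover : ((Icc 1 ⌊X⌋₊).filter fun n => ¬ IsTypical P₁ Q₁ X₀ n) ⊆ Js.biUnion bad := by
    intro n hn
    rw [Finset.mem_filter] at hn
    obtain ⟨hn1, hn2⟩ := hn
    simp only [IsTypical, not_forall, exists_prop] at hn2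
    obtain ⟨j, hj1, hjE, hjn⟩ := hn2
    rw [Finset.mem_biUnion]
    refine ⟨j, ?_, ?_⟩
    · rw [hJs, Finset.mem_filter, Finset.mem_Icc]
      refine ⟨⟨hj1, ?_⟩, hjE⟩
      exact Nat.le_floor (index_le_sqrt_log hj1 hQ0 hlogQ1 hjE)
    · rw [hbad, Finset.mem_filter]
      exact ⟨hn1, hjn⟩
  have hcardJs : (#Js : ℝ) ≤ u := by
    calc (#Js : ℝ) ≤ #(Icc 1 Jm) := by exact_mod_cast Finset.card_filter_le _ _
      _ = Jm := by simp
      _ ≤ Real.sqrt (Real.log X₀) := Nat.floor_le (Real.sqrt_nonneg _)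
      _ ≤ u := hsqrt_le
  -- each bad set
  have hbadj : ∀ j ∈ Js, (#(bad j) : ℝ) ≤
      C₀ * X * (Real.log P₁ / Real.log Q₁) / (j : ℝ) ^ 2 + (E + 1) ^ (10 : ℕ) := by
    intro j hj
    rw [hJs, Finset.mem_filter, Finset.mem_Icc] at hj
    obtain ⟨⟨hj1, -⟩, hjE⟩ := hj
    have hPj : 2 ≤ seqP P₁ Q₁ j := hP2.trans (le_seqP (by linarith) hlogQ1)
    have hPQj : seqP P₁ Q₁ j ≤ seqQ Q₁ j := seqP_le_seqQ hj1 hlogP.le hlogPQ hPQ.le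
    have h := hsieve (seqP P₁ Q₁ j) (seqQ Q₁ j) X hPj hPQj hX0.le
    rw [log_seqP_div_log_seqQ hj1 hlogQ0.ne'] at h
    refine h.trans ?_
    have hQj0 : 0 ≤ seqQ Q₁ j := (seqQ_pos hQ0 j).le
    have : (seqQ Q₁ j + 1) ^ (10 : ℕ) ≤ (E + 1) ^ (10 : ℕ) :=
      pow_le_pow_left₀ (by linarith) (by linarith) _
    have e : C₀ * X * (Real.log P₁ / Real.log Q₁ / (j : ℝ) ^ 2) =
        C₀ * X * (Real.log P₁ / Real.log Q₁) / (j : ℝ) ^ 2 := by ring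
    linarith
  -- sum over `j`
  have hsum_inv_sq : ∑ j ∈ Js, ((j : ℝ) ^ 2)⁻¹ ≤ 2 := by
    calc ∑ j ∈ Js, ((j : ℝ) ^ 2)⁻¹ ≤ ∑ j ∈ Ioo 0 (Jm + 1), ((j : ℝ) ^ 2)⁻¹ := by
          refine Finset.sum_le_sum_of_subset_of_nonneg ?_ fun j _ _ => by positivity
          intro j hj
          rw [hJs, Finset.mem_filter, Finset.mem_Icc] at hj
          rw [Finset.mem_Ioo]; omega
      _ ≤ 2 / ((0 : ℕ) + 1 : ℝ) := sum_Ioo_inv_sq_le 0 (Jm + 1)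
      _ = 2 := by norm_num
  have hrem : u * (E + 1) ^ (10 : ℕ) ≤ X / Real.log X := by
    have h1 : (E + 1) ^ (10 : ℕ) ≤ (2 : ℝ) ^ (10 : ℕ) * Real.exp (10 * u) := by
      calc (E + 1) ^ (10 : ℕ) ≤ (2 * Real.exp u) ^ (10 : ℕ) :=
            pow_le_pow_left₀ (by linarith) (by linarith [Real.add_one_le_exp u, hEu]) _
        _ = (2 : ℝ) ^ (10 : ℕ) * Real.exp (10 * u) := by
            rw [mul_pow, ← Real.exp_nat_mul]; norm_num
    have hg := growth_aux hu40
    rw [hu2, Real.exp_log hX0] at hg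
    have hlogXpos : 0 < Real.log X := by linarith
    rw [le_div_iff₀ hlogXpos, ← hu2]
    have hu0 : 0 < u := by linarith
    calc u * (E + 1) ^ (10 : ℕ) * u ^ 2 ≤ u * ((2 : ℝ) ^ (10 : ℕ) * Real.exp (10 * u)) * u ^ 2 := by
          gcongr
      _ = (2 : ℝ) ^ (10 : ℕ) * u ^ 3 * Real.exp (10 * u) := by ring
      _ ≤ X := hg
  have hXlog : X / Real.log X ≤ (Real.log P₁ / Real.log Q₁) * X := by
    have hlogXpos : 0 < Real.log X := by linarith
    calc X / Real.log X = (1 / Real.log X) * X := by ring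
      _ ≤ (Real.log P₁ / Real.log Q₁) * X := by
          refine mul_le_mul_of_nonneg_right ?_ hX0.le
          calc 1 / Real.log X ≤ 2 / Real.log X :=
                div_le_div_of_nonneg_right (by norm_num) hlogXpos.le
            _ ≤ _ := hratio
  calc (#((Icc 1 ⌊X⌋₊).filter fun n => ¬ IsTypical P₁ Q₁ X₀ n) : ℝ)
      ≤ #(Js.biUnion bad) := by exact_mod_cast Finset.card_le_card hcover
    _ ≤ ∑ j ∈ Js, (#(bad j) : ℝ) := by exact_mod_cast Finset.card_biUnion_le
    _ ≤ ∑ j ∈ Js, (C₀ * X * (Real.log P₁ / Real.log Q₁) / (j : ℝ) ^ 2 + (E + 1) ^ (10 : ℕ)) :=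
        Finset.sum_le_sum hbadj
    _ = C₀ * X * (Real.log P₁ / Real.log Q₁) * ∑ j ∈ Js, ((j : ℝ) ^ 2)⁻¹ +
          #Js * (E + 1) ^ (10 : ℕ) := by
        rw [Finset.sum_add_distrib, Finset.sum_const, nsmul_eq_mul, Finset.mul_sum]
        congr 1
    _ ≤ C₀ * X * (Real.log P₁ / Real.log Q₁) * 2 + u * (E + 1) ^ (10 : ℕ) := by
        gcongr
    _ ≤ C₀ * X * (Real.log P₁ / Real.log Q₁) * 2 + (Real.log P₁ / Real.log Q₁) * X := by
        linarith [hrem, hXlog]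
    _ = (2 * C₀ + 1) * (Real.log P₁ / Real.log Q₁) * X := by ring

end MRT2015

end Literature.NumberTheory.LFunctions
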